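import Summits.ResolutionOfSingularities.ResolutionOfSingularities.Theorems.EquisingularLiftEquisingularLiftNatExactShadowSection
import Summits.ResolutionOfSingularities.ResolutionOfSingularities.Theorems.EquisingularLiftEquisingularLiftNatBlowupChartMorphism
import HarnessLib

/-!
# [OURS · L1 W4.5(b) · EL♮(3)] E-NEG(1), part (iv)(c-1) — two comparable primes of a chart algebra of the restricted centre at the point of
# `V(D♭)_red` under `q` give two specialising points of the exact shadow over `q`; so an exact shadow admits NO such pair
# (crux `EquisingularLiftNatThree` = stmt-ResolutionOfSingularities-20148, parent stmt-20038)

NOT a statement of any manuscript. Helper file of the chain res-L1-w45b (cell `res-hironaka`, rung L, slot W4.5(b)); AI-written, weaker than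
expert review; filed `--supports stmt-ResolutionOfSingularities-20148 --as helper`; it closes nothing. Object (O1) E-NEG(1) of res-L1-w45b-plan-1's
PLANNER-MEMO-g9-1 v1.1, conclusion (iv) (equimultiplicity), scheme route (res-L1-w45b-plan-1 WORD 2026-08-27T15:36:49Z (2): stub-4 holds (iv)(a)+(c)).

SETTING (as part 2 `…NatExactShadowSection`, p529064). `O` a DVR, `τ₁ : X₁ → P`, `r : P → Spec O`, `s : Spec O → X₁`, `τ : X₂ → X₁` the blow-up
along `ker s`, `Γ ⊆ X₁` with `Γ ∖ supp ker s` infinite, `C` an ideal sheaf on `X₂` with `V(C)` integral whose special fibre is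
`closure τ⁻¹(Γ ∖ supp ker s)` as a set; `D♭ := τ(supp C)` (closed), `V(D♭)_red` its reduced subscheme with inclusion `ι`, `z` a point of it,
`c : Fin k → 𝒪_{V(D♭)_red, z}` generators of the restricted centre `(ker s · 𝒪)_z`, and `j` a chart index.

CONTENT.
* **`exists_specializes_ne_fibre_of_chartPrimes_of_exactShadow`** — two primes `𝔔₁ ≤ 𝔔₀`, `𝔔₁ ≠ 𝔔₀`, of the chart algebra
  `𝒪_{V(D♭)_red, z}[K_z/c_j]` lying over `𝔪_z` give two DISTINCT points `c₁ ⤳ c₀` of `supp C` over `ι z`: `V(supp C)_red → V(D♭)_red` is the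
  blow-up of the restricted centre (`exists_isBlowup_reducedStrictTransform_closed` + part 1 (ii)), and res-L1-w45b-stub-2's T-PTPRIME-DICT (4)
  `exists_specializes_ne_of_chartPrime_le` (p544313) reads the two primes as points of that blow-up — the generalisation of part 2's
  `exists_specializes_ne_fibre_of_exactShadow` (which took a QUASI-REGULAR pair, T-FIBRE).
* **`not_chartPrimes_of_exactShadow`** — hence, if the fibre of `supp C` over `q = s(s₀)` is zero-dimensional (`hfib` of part 2), the chart algebras
  at the point under `q` carry NO such pair of primes. Part (iv)(c-2) (`…NatNonEquimultipleChartPrimes`) PRODUCES such a pair from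
  NON-equimultiplicity (stub-2's ring core p543997), so the lift is equimultiple: part (iv)(a).

References: The Stacks Project, Tags 080E, 0804, 0805 — through the cited tree files. OURS planning text (index only): L/w45b/PLANNER-MEMO-g9-1.md v1.1.
-/

set_option linter.dupNamespace false -- mandated namespace `Summit.<Summit>.<Problem>` of this single-conjunct summit
set_option linter.overlappingInstances false -- signatures carry `[IsDomain O] [IsDiscreteValuationRing O]`

noncomputable section

open CategoryTheory AlgebraicGeometry TopologicalSpace Topology IsLocalRing
open AlgebraicGeometry.Scheme.IdealSheafData Literature.AlgebraicGeometry.Resolution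

namespace Summit.ResolutionOfSingularities.ResolutionOfSingularities.Cruxes.EquisingularLiftNat.Sections

section Fibre

variable {O : Type} [CommRing O] [IsDomain O] [IsDiscreteValuationRing O] {P X₁ X₂ : Scheme.{0}}
  [IsLocallyNoetherian X₁] [IsLocallyNoetherian X₂]

/-- **Two comparable primes of a chart algebra of the restricted centre give two specialising points of the shadow.** In the SETTING, let
`z` be a point of `V(D♭)_red`, `c` generators of the restricted centre `(ker s · 𝒪_{V(D♭)_red})_z`, `j` a chart index, and `𝔔₁ ≤ 𝔔₀` two
distinct primes of `𝒪_{V(D♭)_red, z}[K_z/c_j]` lying over `𝔪_z`. Then the fibre of `supp C` over `ι z` contains two DISTINCT points `c₁ ⤳ c₀`.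
[cite: StacksProject, Tag 080E and Tag 0804] [OURS · L1 W4.5b] -/
theorem exists_specializes_ne_fibre_of_chartPrimes_of_exactShadow (r : P ⟶ Spec (.of O)) (τ₁ : X₁ ⟶ P) (s : Spec (.of O) ⟶ X₁)
    (τ : X₂ ⟶ X₁) (hτ : IsBlowup τ s.ker) (Γ : Set X₁) (hΓinf : (Γ \ (s.ker.support : Set X₁)).Infinite)
    (C : X₂.IdealSheafData) (hCint : IsIntegral C.subscheme)
    (hCsp : (C.support : Set X₂) ∩ (CategoryStruct.comp τ (CategoryStruct.comp τ₁ r)) ⁻¹' {closedPoint O} =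
      closure (τ ⁻¹' (Γ \ (s.ker.support : Set X₁))))
    (hD : IsClosed (τ '' (C.support : Set X₂))) (z : ↥(vanishingIdeal (⟨τ '' (C.support : Set X₂), hD⟩ : Closeds X₁)).subscheme)
    {k : ℕ} (c : Fin k → (vanishingIdeal (⟨τ '' (C.support : Set X₂), hD⟩ : Closeds X₁)).subscheme.presheaf.stalk z)
    (hc : Ideal.span (Set.range c) =
      stalkIdeal (s.ker.comap (vanishingIdeal (⟨τ '' (C.support : Set X₂), hD⟩ : Closeds X₁)).subschemeι) z)
    (j : Fin k) (𝔔₁ 𝔔₀ : PrimeSpectrum (blowupAlgebra (Ideal.span (Set.range c)) (c j)))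
    (h𝔔₁ : 𝔔₁.asIdeal.comap (algebraMap _ (blowupAlgebra (Ideal.span (Set.range c)) (c j))) =
      maximalIdeal ((vanishingIdeal (⟨τ '' (C.support : Set X₂), hD⟩ : Closeds X₁)).subscheme.presheaf.stalk z))
    (h𝔔₀ : 𝔔₀.asIdeal.comap (algebraMap _ (blowupAlgebra (Ideal.span (Set.range c)) (c j))) =
      maximalIdeal ((vanishingIdeal (⟨τ '' (C.support : Set X₂), hD⟩ : Closeds X₁)).subscheme.presheaf.stalk z))
    (hle : 𝔔₁.asIdeal ≤ 𝔔₀.asIdeal) (hne : 𝔔₁ ≠ 𝔔₀) :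
    ∃ c₁ c₀ : X₂, c₁ ∈ (C.support : Set X₂) ∧ c₀ ∈ (C.support : Set X₂) ∧
      τ c₁ = (vanishingIdeal (⟨τ '' (C.support : Set X₂), hD⟩ : Closeds X₁)).subschemeι z ∧
      τ c₀ = (vanishingIdeal (⟨τ '' (C.support : Set X₂), hD⟩ : Closeds X₁)).subschemeι z ∧ c₁ ≠ c₀ ∧ c₁ ⤳ c₀ := by
  haveI : IsProper τ := hτ.isProper
  set ι₁ := (vanishingIdeal (⟨τ '' (C.support : Set X₂), hD⟩ : Closeds X₁)).subschemeι with hι₁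
  -- the reduced strict transform `V(supp C)_red → V(D♭)_red` is the blow-up along the restricted centre
  obtain ⟨ρ, hρι, -, hρb⟩ :=
    exists_isBlowup_reducedStrictTransform_closed X₁ X₂ τ s.ker hτ (τ '' (C.support : Set X₂)) hD
  set ι₂ := (vanishingIdeal (⟨closure (τ ⁻¹' (τ '' (C.support : Set X₂) \ (s.ker.support : Set X₁))), isClosed_closure⟩ :
    Closeds X₂)).subschemeι with hι₂
  -- part 1 (ii): `supp C` IS that strict transform
  have hSt : (C.support : Set X₂) = closure (τ ⁻¹' (τ '' (C.support : Set X₂) \ (s.ker.support : Set X₁))) :=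
    (support_eq_strictTransform_image_of_exactShadow r τ₁ s τ hτ Γ hΓinf C hCint hCsp).2
  have hrange : Set.range ι₂ = closure (τ ⁻¹' (τ '' (C.support : Set X₂) \ (s.ker.support : Set X₁))) := by
    rw [hι₂, ComponentGluing.range_subschemeι_vanishingIdeal]
    rfl
  have hmemC : ∀ t, ι₂ t ∈ (C.support : Set X₂) := fun t => by
    have h1 : ι₂ t ∈ Set.range ι₂ := ⟨t, rfl⟩
    rw [hrange] at h1
    rw [Set.ext_iff] at hSt
    exact (hSt _).mpr h1
  -- T-PTPRIME-DICT (4) on `ρ`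
  obtain ⟨x₁, x₀, hsp, hne', ⟨hx₁, -⟩, ⟨hx₀, -⟩⟩ := exists_specializes_ne_of_chartPrime_le hρb z c hc j 𝔔₁ 𝔔₀ h𝔔₁ h𝔔₀ hle hne
  have hτι : ∀ t, ρ t = z → τ (ι₂ t) = ι₁ z := fun t ht => by
    rw [← Scheme.Hom.comp_apply, ← hρι, Scheme.Hom.comp_apply, ht]
  exact ⟨ι₂ x₁, ι₂ x₀, hmemC x₁, hmemC x₀, hτι x₁ hx₁, hτι x₀ hx₀, fun h => hne' (ι₂.isClosedEmbedding.injective h),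
    hsp.map ι₂.continuous⟩

/-- **E-NEG(1) (iv), scheme half — an exact shadow admits no comparable pair of primes over the point under `q`.** In the SETTING, suppose the
fibre of `supp C` over `q = s(s₀)` is ZERO-DIMENSIONAL (no two distinct points `c₁ ⤳ c₀` of `supp C` over `q` — `hfib` of part 2). Then at the
point `z` of `V(D♭)_red` under `q`, for all generators `c` of the restricted centre and every chart `j`, the chart algebra `𝒪_{V(D♭)_red, z}[K_z/c_j]`
has NO two distinct comparable primes over `𝔪_z`. (Part (iv)(c-2) produces such a pair from non-equimultiplicity.)
[cite: StacksProject, Tag 080E and Tag 0804] [OURS · L1 W4.5b] -/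
theorem not_chartPrimes_of_exactShadow (r : P ⟶ Spec (.of O)) (τ₁ : X₁ ⟶ P) (s : Spec (.of O) ⟶ X₁)
    (τ : X₂ ⟶ X₁) (hτ : IsBlowup τ s.ker) (Γ : Set X₁) (hΓinf : (Γ \ (s.ker.support : Set X₁)).Infinite)
    (C : X₂.IdealSheafData) (hCint : IsIntegral C.subscheme)
    (hCsp : (C.support : Set X₂) ∩ (CategoryStruct.comp τ (CategoryStruct.comp τ₁ r)) ⁻¹' {closedPoint O} =
      closure (τ ⁻¹' (Γ \ (s.ker.support : Set X₁))))
    (hfib : ∀ c₁ c₀ : X₂, c₁ ∈ (C.support : Set X₂) → c₀ ∈ (C.support : Set X₂) → τ c₁ = s (closedPoint O) →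
      τ c₀ = s (closedPoint O) → c₁ ⤳ c₀ → c₁ = c₀)
    (hD : IsClosed (τ '' (C.support : Set X₂))) (z : ↥(vanishingIdeal (⟨τ '' (C.support : Set X₂), hD⟩ : Closeds X₁)).subscheme)
    (hz : (vanishingIdeal (⟨τ '' (C.support : Set X₂), hD⟩ : Closeds X₁)).subschemeι z = s (closedPoint O))
    {k : ℕ} (c : Fin k → (vanishingIdeal (⟨τ '' (C.support : Set X₂), hD⟩ : Closeds X₁)).subscheme.presheaf.stalk z)
    (hc : Ideal.span (Set.range c) =
      stalkIdeal (s.ker.comap (vanishingIdeal (⟨τ '' (C.support : Set X₂), hD⟩ : Closeds X₁)).subschemeι) z)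
    (j : Fin k) (𝔔₁ 𝔔₀ : PrimeSpectrum (blowupAlgebra (Ideal.span (Set.range c)) (c j)))
    (h𝔔₁ : 𝔔₁.asIdeal.comap (algebraMap _ (blowupAlgebra (Ideal.span (Set.range c)) (c j))) =
      maximalIdeal ((vanishingIdeal (⟨τ '' (C.support : Set X₂), hD⟩ : Closeds X₁)).subscheme.presheaf.stalk z))
    (h𝔔₀ : 𝔔₀.asIdeal.comap (algebraMap _ (blowupAlgebra (Ideal.span (Set.range c)) (c j))) =
      maximalIdeal ((vanishingIdeal (⟨τ '' (C.support : Set X₂), hD⟩ : Closeds X₁)).subscheme.presheaf.stalk z))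
    (hle : 𝔔₁.asIdeal ≤ 𝔔₀.asIdeal) : 𝔔₁ = 𝔔₀ := by
  by_contra hne
  obtain ⟨c₁, c₀, h₁, h₀, hτ₁, hτ₀, hne', hsp⟩ := exists_specializes_ne_fibre_of_chartPrimes_of_exactShadow r τ₁ s τ hτ Γ hΓinf C
    hCint hCsp hD z c hc j 𝔔₁ 𝔔₀ h𝔔₁ h𝔔₀ hle hne
  rw [hz] at hτ₁ hτ₀
  exact hne' (hfib c₁ c₀ h₁ h₀ hτ₁ hτ₀ hsp)

end Fibre

end Summit.ResolutionOfSingularities.ResolutionOfSingularities.Cruxes.EquisingularLiftNat.Sections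

end
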